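import Summits.BirchSwinnertonDyer.BirchSwinnertonDyer.Theorems.GenusKolyvaginAtTwoK4PosTwinBsdRoadNonPhantom
import Summits.BirchSwinnertonDyer.BirchSwinnertonDyer.Theorems.GenusKolyvaginAtTwoGenusPrimitiveSupplyAtTwoPosDiscShallowKFourPosHalvingDescentCorollaries
import HarnessLib

/-!
# Route `GenusKolyvaginAtTwo`, K₄⁺ kernel `K4Pos` (stmt-BirchSwinnertonDyer-31469):
# K₄⁺ ON ITS DEPTH-ONE SUB-CELL IS A THEOREM MODULO Q2 ALONE — ON AND OFF THE CUT (the cut-free twin of item 33819 `K4PosDepthOneOnCut`)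

Width seat `bsd-line-gk2-p4` g32 (cell `bsd-f1-sign2`), WIDTH-5 attach on route `GenusKolyvaginAtTwo` rev 59.  `--supports stmt-BirchSwinnertonDyer-31469
--as helper`.  THEOREMS ONLY (no definition, no named fact, no `sorry`); standard axioms.  **BSD is NOT proved by this file; `K4Pos` (all depths) is NOT
proved; no item is closed by it.**  CONDITIONAL on Q2 `KolyvaginRelationAtTwo` (stmt-BirchSwinnertonDyer-24880, displayed as a hypothesis).

WHY.  gk2-p5 g36 / gk2-p3 g31 closed the depth-one support item `K4PosDepthOneOnCut` (33819): K₄⁺ with `M₀ = 1` on the MULTIPLICATIVE CUT, modulo Q2 —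
the cut entering ONLY as the source of the engine hypothesis `(NPh_K)` (`NonPhantomPow.nonPhantomAtTwo_of_hasMultiplicativeReductionAt`), fed to the LEAD's
cut-free B2Q♭ master `PlusDescent.exists_transpositionDeep_primitive_of_two_pow_pred_smul_ne_zero_of_nonPhantom`.  This seat proved `(NPh_K)` on the WHOLE
K₄⁺ cell at every `2`-split Heegner frame from the REAL place (`…K4PosTwinBsdRoadNonPhantom`, p782733: `RealWitness.nonPhantom_of_kFourPos_twoSplit`).
Substituting it for the Tate prime:
* ★★ `kFourPos_conclusion_of_depth_one_of_twoSplit` — **the conclusion of `K4Pos` on its depth-one sub-cell (`M₀ = 1`), binders = K4Pos VERBATIM with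
  `1 ≤ M₀` replaced by `M₀ = 1` (= item 33819's binders WITHOUT the cut `v, 2 ∉ v, N ∈ v, multiplicative at v`), modulo Q2 only.**  The prime frame
  of K4Pos carries `2` split, which is all the real-place engine needs.  GK2-INTERNAL (no WALL row, no U₂): the first honest piece of K₄⁺ OFF the cut.
* `kFourPos_shape_of_depth_le_one_of_twoSplit` — the same in the LEAD's «shape» currency (`4 ∤ P(1)`, `1 < #Sel₂(E)`, `w(E) = +1`, the K₄⁺ real
  clause; no datum-divisibility, no twin).
READING (census; nothing closed): K₄⁺ = (depth one: THEOREM mod Q2, this file) + (depth ≥ 2: open; = WALL row 1 + U₂ + Q2 + PRINT by LINE 33's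
`K4Pos_of_wall_U2_nonPhantom`, inter-route).  The pen may file `K4PosDepthOne` (33819 with the four cut binders deleted) — this theorem is its closer
by eta-expansion.  BSD is NOT proved by any of this.

References: [McCallumLMS1991] §5 Lemma 5.3, Thm. 5.4; [Kolyvagin1989Izv] Thm. B₂, §3; [GrossLMS1991] §4; [LawsonWuthrich2016] §7.1;
[MazurRubin2010] Lemma 3.2.
-/

set_option autoImplicit false
set_option linter.dupNamespace false -- `Summit.<P>.<Sub>` repeats `BirchSwinnertonDyer` (D-0017)

noncomputable section

open scoped Classical NumberField

namespace Summit.BirchSwinnertonDyer.BirchSwinnertonDyer.Theorems.GenusExact.Lw2PhantomExclusion.RealWitness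

open WeierstrassCurve Field NumberField IsDedekindDomain
open Literature.NumberTheory.EllipticCurves Literature.NumberTheory.GaloisRepresentations Literature.NumberTheory.EllipticCurves.ModularForms
open Summit.BirchSwinnertonDyer.BirchSwinnertonDyer.Theses.GenusKolyvaginAtTwo (KolyvaginRelationAtTwo)
open Summit.BirchSwinnertonDyer.BirchSwinnertonDyer.Theorems.GenusExact.PlusDescent
  (exists_transpositionDeep_primitive_of_two_pow_pred_smul_ne_zero_of_nonPhantom)

/-- **K₄⁺ SHAPE AT DEPTH `≤ 1`, CUT-FREE, modulo Q2** (the LEAD's `kFourPos_shape_of_depth_le_one` with the multiplicative prime replaced by the K₄⁺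
real clause and `2` split in `K`): `W/ℚ` globally minimal elliptic, non-CM, `C(W)` odd, `ρ_{E,2^n}` onto, `Δ_E > 0`, some `2`-Selmer class of `E`
non-trivial at `∞`, `1 < #Sel₂(E)`; `K` imaginary quadratic, `d_K` odd `≠ −3`, Heegner, the two B₂ non-squares, `2` SPLIT; a depth-`1` datum `d₁` with
`4 ∤ P(1)`; `w(E) = +1`.  Then a square-free `n` of transposition-deep Kolyvagin primes (index `≥ 2`, a Frobenius moving a point of `E[2]`) and a datum
of conductor `n` with `P(n) ∉ 2E(K[n])` exist.  Proof: a non-zero `s₀ ∈ Sel₂(E/ℚ)` has `2^{1−1} • s₀ ≠ 0`; B2Q♭ (`…_of_nonPhantom`) with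
`(NPh_K)` := `nonPhantom_of_kFourPos_twoSplit`.  BSD is NOT proved by this. [cite: McCallumLMS1991, §5 Lemma 5.3, Thm. 5.4] [cite: Kolyvagin1989Izv, Thm. B₂] -/
theorem kFourPos_shape_of_depth_le_one_of_twoSplit (hQ2 : KolyvaginRelationAtTwo)
    (W : WeierstrassCurve ℚ) [W.IsElliptic] [W.IsGloballyMinimal] [NeZero (W.conductorNorm ℤ)] (hcm : ¬ W.HasCM)
    (hT : Odd W.tamagawaProduct) (hρ : ∀ n : ℕ, 0 < n → W.HasSurjectiveModNGaloisRep ((2 : ℤ) ^ n)) (hpos : 0 < W.Δ)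
    (hcell : Nat.card (W.selmerGroup 2) = 4 ∧ ∃ c ∈ (W.kummerSelmerStructure ((2 : ℕ) : ℤ)).selmerGroup,
      galoisCohomology.localization (W.torsionGaloisModule ((2 : ℕ) : ℤ)) (Sum.inl Rat.infinitePlace) 1 c ≠ 0)
    (K : Type) [Field K] [NumberField K] (hIQ : IsImaginaryQuadratic K) (hodd : Odd (NumberField.discr K))
    (h3 : NumberField.discr K ≠ -3) (hHe : SatisfiesHeegnerHypothesis (W.conductorNorm ℤ) K)
    (hsq1 : ¬ IsSquare ((NumberField.discr K : ℚ) * -|W.Δ|)) (hsq2 : ¬ IsSquare ((NumberField.discr K : ℚ) * (-(2 * |W.Δ|))))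
    (h2K : ((Ideal.span {(2 : ℤ)}).primesOver (𝓞 K)).ncard = 2)
    (Dt : ModularParametrizationData W (W.conductorNorm ℤ)) (β : ℤ) (ι : K →+* ℂ) (d₁ : KolyvaginHeegnerData Dt β ι 1)
    (hndiv : ¬ ∃ Q : (W.baseChange (ringClassField K ι 1)).toAffine.Point, ((2 ^ (1 + 1) : ℕ) : ℤ) • Q = d₁.derivedPoint)
    (hw1 : W.rootNumber = 1) :
    ∃ (n : ℕ) (d : KolyvaginHeegnerData Dt β ι n), Squarefree n ∧
      (∀ ℓ ∈ n.primeFactors, Zhang2014.IsKolyvaginPrime (W.conductorNorm ℤ) W K 2 ℓ ∧ 2 ≤ Zhang2014.kolyvaginIndex W 2 ℓ ∧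
        ∃ (v : HeightOneSpectrum (𝓞 ℚ)) (𝔓 : Ideal (absIntegers (𝓞 ℚ) ℚ)) (h : absoluteGaloisGroup ℚ),
          ((ℓ : ℕ) : 𝓞 ℚ) ∈ v.asIdeal ∧ 𝔓 ∈ v.primesAbove ∧ IsArithFrobAt (𝓞 ℚ) h 𝔓 ∧ ∃ u : W.geomTorsion ((2 : ℕ) : ℤ), h • u ≠ u) ∧
      ¬ ∃ Q : (W.baseChange (ringClassField K ι n)).toAffine.Point, (2 : ℤ) • Q = d.derivedPoint := by
  -- `(NPh_K)` from the real place (this seat), in the all-places form B2Q♭ consumes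
  have hNPh := nonPhantom_of_kFourPos_twoSplit W hρ hpos hcell K hIQ hodd hHe hsq1 hsq2 h2K
  -- a non-zero `2`-Selmer class over `ℚ`, at level `2 = 2^1`
  have hSel' : 1 < Nat.card (selmerGroup W ((2 ^ 1 : ℕ) : ℤ)) := by rw [pow_one, Nat.cast_ofNat, hcell.1]; norm_num
  have hbot : selmerGroup W ((2 ^ 1 : ℕ) : ℤ) ≠ ⊥ := fun h ↦ by rw [h, AddSubgroup.card_bot] at hSel'; exact lt_irrefl _ hSel'
  obtain ⟨⟨s₀, hs₀⟩, hne⟩ := AddSubgroup.ne_bot_iff_exists_ne_zero.mp hbot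
  have hne' : ((2 ^ (1 - 1) : ℕ) : ℤ) • s₀ ≠ 0 := by
    rw [Nat.sub_self, pow_zero, Nat.cast_one, one_zsmul]
    rintro rfl
    exact hne (Subtype.ext rfl)
  obtain ⟨ℓ, d, hkol, hidx, ⟨v', 𝔓, h, c₀, hℓv, h𝔓, hh, -, -, hhu, -⟩, -, -, hwit⟩ :=
    exists_transpositionDeep_primitive_of_two_pow_pred_smul_ne_zero_of_nonPhantom hQ2 W hcm hT K hIQ hodd h3 hHe hρ hNPh Dt β ι d₁ 1
      hndiv hw1 1 s₀ hs₀ hne'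
  have hℓp : ℓ.Prime := hkol.1
  refine ⟨1 * ℓ, d, by rw [one_mul]; exact hℓp.squarefree, fun q hq ↦ ?_, hwit⟩
  rw [one_mul, hℓp.primeFactors, Finset.mem_singleton] at hq
  subst hq
  exact ⟨hkol, hidx, v', 𝔓, h, hℓv, h𝔓, hh, hhu⟩

/-- ★★ **K4Pos ON ITS DEPTH-ONE SUB-CELL, CUT-FREE, modulo Q2 — the binders of `K4Pos` VERBATIM with `1 ≤ M₀` replaced by `M₀ = 1`** (= item 33819
`K4PosDepthOneOnCut` with its four cut binders `v, 2 ∉ v, N ∈ v, multiplicative at v` DELETED): habitat, `Δ > 0`, the real-narrow `#Sel₂(E) = 4` cell,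
PRIME Heegner frame with `2` split, odd-Manin datum, `2^{M₀} ∥ P(1)` with `M₀ = 1`, shallow Sel₂-minimal rank-`1` twin ⊢ the conclusion of K4Pos.
`w(E) = +1` from `r_an(E) = 0` (functional equation of the newform of `Dt`); most binders are idle and displayed for by-name use.  GK2-internal: no WALL
row, no U₂.  BSD is NOT proved by this; K4Pos (depth ≥ 2) is NOT closed by this. [cite: McCallumLMS1991, §5 Thm. 5.4] [cite: Kolyvagin1989Izv, Thm. B₂]
[cite: LawsonWuthrich2016, §7.1] [cite: MazurRubin2010, Lemma 3.2] -/
theorem kFourPos_conclusion_of_depth_one_of_twoSplit (hQ2 : KolyvaginRelationAtTwo)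
    (W : WeierstrassCurve ℚ) [W.IsElliptic] [W.IsGloballyMinimal] [NeZero (W.conductorNorm ℤ)] (hcm : ¬ W.HasCM) (hr0 : W.analyticRank = 0)
    (hρ : ∀ n : ℕ, 0 < n → W.HasSurjectiveModNGaloisRep ((2 : ℤ) ^ n)) (hT : Odd W.tamagawaProduct) (hpos : 0 < W.Δ)
    (hcell : Nat.card (W.selmerGroup 2) = 4 ∧ ∃ c ∈ (W.kummerSelmerStructure ((2 : ℕ) : ℤ)).selmerGroup,
      galoisCohomology.localization (W.torsionGaloisModule ((2 : ℕ) : ℤ)) (Sum.inl Rat.infinitePlace) 1 c ≠ 0)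
    (K : Type) [Field K] [NumberField K] (hIQ : IsImaginaryQuadratic K) (hodd : Odd (NumberField.discr K))
    (h3 : NumberField.discr K ≠ -3) (hHe : SatisfiesHeegnerHypothesis (W.conductorNorm ℤ) K)
    (hsq1 : ¬ IsSquare ((NumberField.discr K : ℚ) * -|W.Δ|)) (hsq2 : ¬ IsSquare ((NumberField.discr K : ℚ) * (-(2 * |W.Δ|))))
    (ℓ₀ : ℕ) (_hℓ₀ : ℓ₀.Prime) (_hdK : NumberField.discr K = -(ℓ₀ : ℤ))
    (h2K : ((Ideal.span {(2 : ℤ)}).primesOver (𝓞 K)).ncard = 2)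
    (Dt : ModularParametrizationData W (W.conductorNorm ℤ))
    (_hopt : ∀ z ∈ Dt.L.lattice, ∃ w ∈ periodLattice Dt.f, z = (Dt.c : ℂ) * w) (_hc : Odd Dt.c)
    (β : ℤ) (ι : K →+* ℂ) (d₁ : KolyvaginHeegnerData Dt β ι 1) (_hy : ¬ IsOfFinAddOrder d₁.derivedPoint) (M₀ : ℕ)
    (_hdiv : ∃ Q : (W.baseChange (ringClassField K ι 1)).toAffine.Point, ((2 ^ M₀ : ℕ) : ℤ) • Q = d₁.derivedPoint)
    (hndiv : ¬ ∃ Q : (W.baseChange (ringClassField K ι 1)).toAffine.Point, ((2 ^ (M₀ + 1) : ℕ) : ℤ) • Q = d₁.derivedPoint)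
    (hM₀ : M₀ = 1)
    (Wd : WeierstrassCurve ℚ) [Wd.IsElliptic] [Wd.IsGloballyMinimal]
    (_hWd : ∃ C : VariableChange ℚ, C • W.quadraticTwist (NumberField.discr K : ℚ) = Wd) (_hrd : Wd.analyticRank = 1)
    (_hSelWd : Nat.card (Wd.selmerGroup 2) = 2) (_hTam : padicValNat 2 Wd.tamagawaProduct = 0) :
    ∃ (n : ℕ) (d : KolyvaginHeegnerData Dt β ι n), Squarefree n ∧
      (∀ ℓ ∈ n.primeFactors, Zhang2014.IsKolyvaginPrime (W.conductorNorm ℤ) W K 2 ℓ ∧ 2 ≤ Zhang2014.kolyvaginIndex W 2 ℓ ∧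
        ∃ (v : HeightOneSpectrum (𝓞 ℚ)) (𝔓 : Ideal (absIntegers (𝓞 ℚ) ℚ)) (h : absoluteGaloisGroup ℚ),
          ((ℓ : ℕ) : 𝓞 ℚ) ∈ v.asIdeal ∧ 𝔓 ∈ v.primesAbove ∧ IsArithFrobAt (𝓞 ℚ) h 𝔓 ∧ ∃ u : W.geomTorsion ((2 : ℕ) : ℤ), h • u ≠ u) ∧
      ¬ ∃ Q : (W.baseChange (ringClassField K ι n)).toAffine.Point, (2 : ℤ) • Q = d.derivedPoint := by
  subst hM₀
  have hw : W.rootNumber = 1 :=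
    (Literature.Barriers.BirchSwinnertonDyer.even_analyticRank_iff_of_isNewformOf_conductorLevel Dt.isNewformOf).mp
      (by rw [hr0]; exact Even.zero)
  exact kFourPos_shape_of_depth_le_one_of_twoSplit hQ2 W hcm hT hρ hpos hcell K hIQ hodd h3 hHe hsq1 hsq2 h2K Dt β ι d₁ hndiv hw

/-! ## APPEND (same seat, same gen): every depth — K₄⁺ from ONE sharp Selmer class, cut-free, modulo Q2 -/

/-- ★★ **K₄⁺ AT EVERY DEPTH FROM ONE SHARP SELMER CLASS, CUT-FREE, modulo Q2** (the LEAD's `kFourPos_shape_of_two_pow_pred_smul_ne_zero` with the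
multiplicative prime replaced by the K₄⁺ real clause and `2` split in `K`; LINE 33's `kFour_shape_offCut_of_nonPhantom` with its `(NPh_K)` hypothesis
DISCHARGED by `nonPhantom_of_kFourPos_twoSplit`).  `W/ℚ` globally minimal elliptic, non-CM, `C(W)` odd, `ρ_{E,2^n}` onto, `Δ_E > 0`, the K₄⁺ real
clause (`#Sel₂(E) = 4`, some `2`-Selmer class non-trivial at `∞`); `K` imaginary quadratic, `d_K` odd `≠ −3`, Heegner, the two B₂ non-squares, `2` SPLIT;
a datum `d₁` with `2^{M₀+1} ∤ P(1)`; `w(E) = +1`; and a class `s₀ ∈ Sel_(2^M)(E/ℚ)` with `2^{M₀−1} • s₀ ≠ 0` (Kolyvagin's B₂ over `ℚ` is SHARP for `E`,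
e.g. a `Ш(E/ℚ)`-class of order `2^{M₀}`).  Then the conclusion of K4Pos holds at this frame: a square-free `n` of transposition-deep Kolyvagin primes
and a datum of conductor `n` with `P(n) ∉ 2E(K[n])`.  So on the WHOLE K₄⁺ cell (no cut) **K4Pos ⟸ Q2 + «`Sel_(2^∞)(E/ℚ)` has a class of order `2^{M₀}`»**
— GK2-internal, no WALL row, no U₂.  BSD is NOT proved by this; K4Pos is NOT proved by this. [cite: McCallumLMS1991, §5 Thm. 5.4] [cite: Kolyvagin1989Izv, Thm. B₂]
[cite: LawsonWuthrich2016, §7.1] [cite: MazurRubin2010, Lemma 3.2] -/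
theorem kFourPos_shape_of_two_pow_pred_smul_ne_zero_of_twoSplit (hQ2 : KolyvaginRelationAtTwo)
    (W : WeierstrassCurve ℚ) [W.IsElliptic] [W.IsGloballyMinimal] [NeZero (W.conductorNorm ℤ)] (hcm : ¬ W.HasCM)
    (hT : Odd W.tamagawaProduct) (hρ : ∀ n : ℕ, 0 < n → W.HasSurjectiveModNGaloisRep ((2 : ℤ) ^ n)) (hpos : 0 < W.Δ)
    (hcell : Nat.card (W.selmerGroup 2) = 4 ∧ ∃ c ∈ (W.kummerSelmerStructure ((2 : ℕ) : ℤ)).selmerGroup,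
      galoisCohomology.localization (W.torsionGaloisModule ((2 : ℕ) : ℤ)) (Sum.inl Rat.infinitePlace) 1 c ≠ 0)
    (K : Type) [Field K] [NumberField K] (hIQ : IsImaginaryQuadratic K) (hodd : Odd (NumberField.discr K))
    (h3 : NumberField.discr K ≠ -3) (hHe : SatisfiesHeegnerHypothesis (W.conductorNorm ℤ) K)
    (hsq1 : ¬ IsSquare ((NumberField.discr K : ℚ) * -|W.Δ|)) (hsq2 : ¬ IsSquare ((NumberField.discr K : ℚ) * (-(2 * |W.Δ|))))
    (h2K : ((Ideal.span {(2 : ℤ)}).primesOver (𝓞 K)).ncard = 2)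
    (Dt : ModularParametrizationData W (W.conductorNorm ℤ)) (β : ℤ) (ι : K →+* ℂ) (d₁ : KolyvaginHeegnerData Dt β ι 1) (M₀ : ℕ)
    (hndiv : ¬ ∃ Q : (W.baseChange (ringClassField K ι 1)).toAffine.Point, ((2 ^ (M₀ + 1) : ℕ) : ℤ) • Q = d₁.derivedPoint)
    (hw1 : W.rootNumber = 1)
    (hsharp : ∃ (M : ℕ) (s₀ : galH1Torsion W ((2 ^ M : ℕ) : ℤ)), s₀ ∈ selmerGroup W ((2 ^ M : ℕ) : ℤ) ∧ ((2 ^ (M₀ - 1) : ℕ) : ℤ) • s₀ ≠ 0) :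
    ∃ (n : ℕ) (d : KolyvaginHeegnerData Dt β ι n), Squarefree n ∧
      (∀ ℓ ∈ n.primeFactors, Zhang2014.IsKolyvaginPrime (W.conductorNorm ℤ) W K 2 ℓ ∧ 2 ≤ Zhang2014.kolyvaginIndex W 2 ℓ ∧
        ∃ (v : HeightOneSpectrum (𝓞 ℚ)) (𝔓 : Ideal (absIntegers (𝓞 ℚ) ℚ)) (h : absoluteGaloisGroup ℚ),
          ((ℓ : ℕ) : 𝓞 ℚ) ∈ v.asIdeal ∧ 𝔓 ∈ v.primesAbove ∧ IsArithFrobAt (𝓞 ℚ) h 𝔓 ∧ ∃ u : W.geomTorsion ((2 : ℕ) : ℤ), h • u ≠ u) ∧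
      ¬ ∃ Q : (W.baseChange (ringClassField K ι n)).toAffine.Point, (2 : ℤ) • Q = d.derivedPoint := by
  have hNPh := nonPhantom_of_kFourPos_twoSplit W hρ hpos hcell K hIQ hodd hHe hsq1 hsq2 h2K
  obtain ⟨M, s₀, hs₀, hne⟩ := hsharp
  obtain ⟨ℓ, d, hkol, hidx, ⟨v', 𝔓, h, c₀, hℓv, h𝔓, hh, -, -, hhu, -⟩, -, -, hwit⟩ :=
    exists_transpositionDeep_primitive_of_two_pow_pred_smul_ne_zero_of_nonPhantom hQ2 W hcm hT K hIQ hodd h3 hHe hρ hNPh Dt β ι d₁ M₀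
      hndiv hw1 M s₀ hs₀ hne
  have hℓp : ℓ.Prime := hkol.1
  refine ⟨1 * ℓ, d, by rw [one_mul]; exact hℓp.squarefree, fun q hq ↦ ?_, hwit⟩
  rw [one_mul, hℓp.primeFactors, Finset.mem_singleton] at hq
  subst hq
  exact ⟨hkol, hidx, v', 𝔓, h, hℓv, h𝔓, hh, hhu⟩

end Summit.BirchSwinnertonDyer.BirchSwinnertonDyer.Theorems.GenusExact.Lw2PhantomExclusion.RealWitness

end
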